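import Summits.CriticalPhenomena.PercolationContinuityZ3.Theorems.PercNearOneGluingNoHeavyPcintMemCertLow
import HarnessLib

/-!
# CriticalPhenomena/PercolationContinuityZ3 — Theorems/PercNearOneGluingNoHeavyPcintMemPad.lean: zero-padding `ℤ^k ↪ ℤ^d` commutes with the memory-`τ` automaton, and fresh axes are interchangeable

Lane prim-pcint, STRUCTURE rule (prim-pcint-2 GEN 18: the second-rung DIMENSION LAW of the loop-exclusion conjecture C4; part 1 of
the transfer principle "the memory-`τ` class automaton is UNIFORM IN THE DIMENSION", continued in …PcintMemUniform /
…PcintMemUniformBounds).  Contents: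

* `padSite` / `padLetter` / `padState` — zero-padding of sites, letters and dangerous-set states of `ℤ^k` into `ℤ^d`;
  `l1_padSite`, `stepVec_padLetter`, `padSite_injective`, **`mstep_pad`**: `mstep τ (pad S) (pad a) = (mstep τ S a).map pad`
  (the proof is the one of `mstep_smul` in …PcintMemCertSym with the symmetry replaced by the padding);
* `padPerm` — a signed permutation of `ℤ^k` padded by the identity; `smulSite_padPerm`, **`smulState_padPerm`** (padded symmetries act
  on padded states as the original ones), so counts from padded canonical rows are still symmetry-invariant;
* `swapPerm`, `smulState_swap_of_zero`, `smulLetter_swap`, **`mstep_fresh`**: if a state vanishes on two axes `u, v`, reading the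
  letter `(v, b)` equals reading `(u, b)` followed by the transposition of `u` and `v` (equivariance `mstep_smul`): all axes off the
  support of a state are interchangeable — the reason the class automaton of memory `6` (supports ≤ 3 axes) is the same in every `d ≥ 4`.

HONEST FRAMING: elementary bookkeeping.  No `sorry`; standard axioms.  Written by prim-pcint-2 gen 18 (prover-prim-pcint-2-g18-0), 2026-08-26.

## References
* A. Pönitz, P. Tittmann, *Improved upper bounds for self-avoiding walks in ℤ^d*, Electron. J. Combin. 7 (2000) R21, §3 [PonitzTittmann2000].
-/

noncomputable section

open Filter Topology
open Literature.Probability.Percolation Literature.Probability.LatticeModels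

namespace Summit.CriticalPhenomena.PercolationContinuityZ3.Theorems.Pcint

/-! ### Zero-padding `ℤ^k ↪ ℤ^d` -/

section Pad

variable {k d : ℕ}

/-- Zero-padding of a site of `ℤ^k` to `ℤ^d` (`k ≤ d`): the first `k` coordinates are kept, the rest are `0`. [folklore] -/
def padSite (d : ℕ) (x : Site k) : Site d := fun i => if hi : (i : ℕ) < k then x ⟨i, hi⟩ else 0

/-- Coordinates below `k` of a padded site. [folklore] -/
theorem padSite_apply_lt (x : Site k) {i : Fin d} (hi : (i : ℕ) < k) :
    padSite d x i = x ⟨i, hi⟩ := by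
  simp [padSite, hi]

/-- Coordinates from `k` on of a padded site vanish. [folklore] -/
theorem padSite_apply_ge (x : Site k) {i : Fin d} (hi : k ≤ (i : ℕ)) : padSite d x i = 0 := by
  simp [padSite, Nat.not_lt.2 hi]

/-- Padding along `Fin.castLE`. [folklore] -/
@[simp] theorem padSite_castLE (h : k ≤ d) (x : Site k) (j : Fin k) : padSite d x (Fin.castLE h j) = x j := by
  rw [padSite_apply_lt x (by exact j.isLt)]
  exact congrArg x (Fin.ext rfl)

/-- Padding is additive. [folklore] -/
theorem padSite_sub (x y : Site k) : padSite d (x - y) = padSite d x - padSite d y := by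
  ext i
  by_cases hi : (i : ℕ) < k
  · simp [padSite, hi]
  · simp [padSite, hi]

/-- Padding commutes with negation. [folklore] -/
theorem padSite_neg (x : Site k) : padSite d (-x) = -padSite d x := by
  ext i
  by_cases hi : (i : ℕ) < k
  · simp [padSite, hi]
  · simp [padSite, hi]

/-- Padding is injective. [folklore] -/
theorem padSite_injective (h : k ≤ d) : Function.Injective (padSite (k := k) d) := by
  intro x y hxy
  ext j
  have := congrFun hxy (Fin.castLE h j)
  simpa using this

/-- Padding preserves the `ℓ¹` norm. [folklore] -/
theorem l1_padSite (h : k ≤ d) (x : Site k) : l1 (padSite d x) = l1 x := by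
  unfold l1
  have hzero : ∀ i ∈ (Finset.univ : Finset (Fin d)), i ∉ (Finset.univ : Finset (Fin k)).map (Fin.castLEEmb h) →
      (padSite d x i).natAbs = 0 := by
    intro i _ hi
    have hik : k ≤ (i : ℕ) := by
      by_contra hlt
      push Not at hlt
      exact hi (Finset.mem_map.2 ⟨⟨i, hlt⟩, Finset.mem_univ _, Fin.ext rfl⟩)
    simp [padSite_apply_ge x hik]
  rw [← Finset.sum_subset (Finset.subset_univ _) hzero, Finset.sum_map]
  refine Finset.sum_congr rfl fun j _ => ?_
  simp [Fin.castLEEmb]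

/-- Padding of letters: the axis index is cast along `Fin.castLE`. [folklore] -/
def padLetter (h : k ≤ d) (a : Fin k × Bool) : Fin d × Bool := (Fin.castLE h a.1, a.2)

/-- A letter of `ℤ^d` on an axis `< k` is a padded letter. [folklore] -/
theorem padLetter_mk (h : k ≤ d) (a : Fin d × Bool) (ha : (a.1 : ℕ) < k) :
    padLetter h (⟨a.1, ha⟩, a.2) = a := by
  rcases a with ⟨j, b⟩
  simp only [padLetter, Prod.mk.injEq, and_true]
  exact Fin.ext rfl

/-- Steps and letters pad together. [folklore] -/
theorem stepVec_padLetter (h : k ≤ d) (a : Fin k × Bool) : stepVec (padLetter h a) = padSite d (stepVec a) := by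
  rcases a with ⟨j, b⟩
  ext i
  by_cases hi : (i : ℕ) < k
  · rw [padSite_apply_lt _ hi]
    have hiff : (i = Fin.castLE h j) ↔ ((⟨i, hi⟩ : Fin k) = j) := by
      constructor
      · intro e; ext; simp [e]
      · intro e; ext; rw [← e]; rfl
    by_cases hij : i = Fin.castLE h j
    · have hj : (⟨i, hi⟩ : Fin k) = j := hiff.1 hij
      subst hj
      cases b <;> simp [stepVec, padLetter]
    · have hj : (⟨i, hi⟩ : Fin k) ≠ j := fun e => hij (hiff.2 e)
      cases b <;> simp [stepVec, padLetter, hij, hj]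
  · have hne : i ≠ Fin.castLE h j := by
      intro e; apply hi; rw [e]; exact j.isLt
    rw [padSite_apply_ge _ (Nat.not_lt.1 hi)]
    cases b <;> simp [stepVec, padLetter, hne]

/-- Padding of states (sitewise, ages unchanged). [folklore] -/
def padState (d : ℕ) (S : MState k) : MState d := S.image fun q => (padSite d q.1, q.2)

/-- Membership in a padded state. [folklore] -/
theorem mem_padState (S : MState k) (q : Site d × ℕ) :
    q ∈ padState d S ↔ ∃ r, (r, q.2) ∈ S ∧ q.1 = padSite d r := by
  rcases q with ⟨x, j⟩
  simp only [padState, Finset.mem_image, Prod.mk.injEq, Prod.exists]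
  constructor
  · rintro ⟨r, j', hr, rfl, rfl⟩; exact ⟨r, hr, rfl⟩
  · rintro ⟨r, hr, rfl⟩; exact ⟨r, j, hr, rfl, rfl⟩

/-- The empty state pads to the empty state. [folklore] -/
@[simp] theorem padState_empty : padState d (∅ : MState k) = ∅ := by
  simp [padState]

/-- Points of a padded state vanish on the axes `≥ k`. [folklore] -/
theorem padState_apply_ge (S : MState k) {q : Site d × ℕ} (hq : q ∈ padState d S) {i : Fin d}
    (hi : k ≤ (i : ℕ)) : q.1 i = 0 := by
  obtain ⟨r, -, hr⟩ := (mem_padState S q).1 hq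
  rw [hr, padSite_apply_ge r hi]

/-- **The memory automaton commutes with zero-padding.** [folklore] -/
theorem mstep_pad (τ : ℕ) (h : k ≤ d) (S : MState k) (a : Fin k × Bool) :
    mstep τ (padState d S) (padLetter h a) = (mstep τ S a).map (padState d) := by
  unfold mstep
  rw [stepVec_padLetter]
  have hcond : (∃ q ∈ padState d S, q.1 = padSite d (stepVec a)) ↔ ∃ q ∈ S, q.1 = stepVec a := by
    constructor
    · rintro ⟨q, hq, hq1⟩
      obtain ⟨r, hr, hqr⟩ := (mem_padState S q).1 hq
      refine ⟨(r, q.2), hr, ?_⟩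
      exact padSite_injective h (by rw [← hqr, hq1])
    · rintro ⟨q, hq, hq1⟩
      refine ⟨(padSite d q.1, q.2), ?_, by rw [hq1]⟩
      exact (mem_padState S _).2 ⟨q.1, by simpa using hq, rfl⟩
  by_cases hx : ∃ q ∈ S, q.1 = stepVec a
  · rw [if_pos (hcond.2 hx), if_pos hx]; rfl
  · rw [if_neg (fun h' => hx (hcond.1 h')), if_neg hx, Option.map_some]
    congr 1
    ext ⟨x, j⟩
    simp only [Finset.mem_insert, Finset.mem_filter, Finset.mem_image, Prod.mk.injEq, Prod.exists,
      padState]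
    constructor
    · rintro (⟨rfl, rfl⟩ | ⟨⟨x', j', ⟨r, n, hrS, hgr, hn⟩, hx, hj⟩, hjτ, hl⟩)
      · exact ⟨-stepVec a, 1, Or.inl ⟨rfl, rfl⟩, by rw [padSite_neg], rfl⟩
      · subst hn; subst hj; subst hgr
        refine ⟨r - stepVec a, n + 1, Or.inr ⟨⟨r, n, hrS, rfl, rfl⟩, hjτ, ?_⟩, ?_, rfl⟩
        · rw [← l1_padSite h, padSite_sub, hx]; exact hl
        · rw [padSite_sub, hx]
    · rintro ⟨a1, b, hmem, hx, hb⟩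
      subst hb
      rcases hmem with ⟨rfl, rfl⟩ | ⟨⟨a2, b1, hS, ha, hb1⟩, hbτ, hl⟩
      · left; exact ⟨by rw [← hx, padSite_neg], rfl⟩
      · right
        refine ⟨⟨padSite d a2, b1, ⟨a2, b1, hS, rfl, rfl⟩, ?_, hb1⟩, hbτ, ?_⟩
        · rw [← padSite_sub, ha, hx]
        · simpa only [← hx, l1_padSite h] using hl

/-- The underlying map of a padded permutation: `π` on the axes `< k`, the identity above. [folklore] -/
def padPermFun (h : k ≤ d) (π : Equiv.Perm (Fin k)) (i : Fin d) : Fin d :=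
  if hi : (i : ℕ) < k then Fin.castLE h (π ⟨i, hi⟩) else i

/-- `padPermFun` on an axis `< k`. [folklore] -/
theorem padPermFun_lt (h : k ≤ d) (π : Equiv.Perm (Fin k)) {i : Fin d} (hi : (i : ℕ) < k) :
    padPermFun h π i = Fin.castLE h (π ⟨i, hi⟩) := by
  simp [padPermFun, hi]

/-- `padPermFun` on an axis `≥ k`. [folklore] -/
theorem padPermFun_ge (h : k ≤ d) (π : Equiv.Perm (Fin k)) {i : Fin d} (hi : k ≤ (i : ℕ)) :
    padPermFun h π i = i := by
  simp [padPermFun, Nat.not_lt.2 hi]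

/-- `padPermFun π⁻¹` inverts `padPermFun π`. [folklore] -/
theorem padPermFun_symm_apply (h : k ≤ d) (π : Equiv.Perm (Fin k)) (i : Fin d) :
    padPermFun h π.symm (padPermFun h π i) = i := by
  by_cases hi : (i : ℕ) < k
  · rw [padPermFun_lt h π hi]
    have hlt : ((Fin.castLE h (π ⟨i, hi⟩) : Fin d) : ℕ) < k := (π ⟨i, hi⟩).isLt
    rw [padPermFun_lt h π.symm hlt]
    ext
    have : (⟨((Fin.castLE h (π ⟨i, hi⟩) : Fin d) : ℕ), hlt⟩ : Fin k) = π ⟨i, hi⟩ := Fin.ext rfl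
    rw [this, Equiv.symm_apply_apply]
    rfl
  · rw [padPermFun_ge h π (Nat.not_lt.1 hi), padPermFun_ge h π.symm (Nat.not_lt.1 hi)]

/-- Padding of a signed permutation of `ℤ^k` to one of `ℤ^d` (identity and `+` signs on the new axes). [folklore] -/
def padPerm (h : k ≤ d) (g : SPerm k) : SPerm d :=
  (⟨padPermFun h g.1, padPermFun h g.1.symm, fun i => by simpa using padPermFun_symm_apply h g.1 i,
      fun i => by simpa using padPermFun_symm_apply h g.1.symm i⟩,
    fun i => if hi : (i : ℕ) < k then g.2 ⟨i, hi⟩ else true)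

/-- Padded symmetries act on padded sites as the original symmetry. [folklore] -/
theorem smulSite_padPerm (h : k ≤ d) (g : SPerm k) (x : Site k) :
    smulSite (padPerm h g) (padSite d x) = padSite d (smulSite g x) := by
  ext i
  by_cases hi : (i : ℕ) < k
  · have h1 : (padPerm h g).1 i = Fin.castLE h (g.1 ⟨i, hi⟩) := padPermFun_lt h g.1 hi
    have h2 : (padPerm h g).2 i = g.2 ⟨i, hi⟩ := by simp [padPerm, hi]
    simp only [smulSite, h1, h2, padSite_castLE, padSite_apply_lt _ hi]
  · have h1 : (padPerm h g).1 i = i := padPermFun_ge h g.1 (Nat.not_lt.1 hi)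
    have h2 : (padPerm h g).2 i = true := by simp [padPerm, hi]
    simp only [smulSite, h1, h2, padSite_apply_ge _ (Nat.not_lt.1 hi), if_true]

/-- Padded symmetries act on padded states as the original symmetry. [folklore] -/
theorem smulState_padPerm (h : k ≤ d) (g : SPerm k) (S : MState k) :
    smulState (padPerm h g) (padState d S) = padState d (smulState g S) := by
  ext q
  rw [mem_smulState, mem_padState]
  constructor
  · rintro ⟨r, hr, hqr⟩
    obtain ⟨r', hr', hrr'⟩ := (mem_padState S (r, q.2)).1 hr
    have hrr : r = padSite d r' := hrr'
    refine ⟨smulSite g r', (mem_smulState g S (smulSite g r', q.2)).2 ⟨r', hr', rfl⟩, ?_⟩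
    rw [hqr, hrr, smulSite_padPerm]
  · rintro ⟨r, hr, hqr⟩
    obtain ⟨r', hr', hrr'⟩ := (mem_smulState g S (r, q.2)).1 hr
    have hrr : r = smulSite g r' := hrr'
    refine ⟨padSite d r', (mem_padState S (padSite d r', q.2)).2 ⟨r', hr', rfl⟩, ?_⟩
    rw [hqr, hrr, smulSite_padPerm]

end Pad

/-! ### Fresh axes are interchangeable -/

section Fresh

variable {d : ℕ}

/-- The transposition of two axes, with `+` signs, as a lattice symmetry. [folklore] -/
def swapPerm (u v : Fin d) : SPerm d := (Equiv.swap u v, fun _ => true)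

/-- A site vanishing on both axes is fixed by their transposition. [folklore] -/
theorem smulSite_swap_of_zero (u v : Fin d) {x : Site d} (hu : x u = 0) (hv : x v = 0) :
    smulSite (swapPerm u v) x = x := by
  ext i
  simp only [smulSite, swapPerm, if_true]
  by_cases hiu : i = u
  · subst hiu; rw [Equiv.swap_apply_left, hv, hu]
  · by_cases hiv : i = v
    · subst hiv; rw [Equiv.swap_apply_right, hu, hv]
    · rw [Equiv.swap_apply_of_ne_of_ne hiu hiv]

/-- A state vanishing on both axes is fixed by their transposition. [folklore] -/
theorem smulState_swap_of_zero (u v : Fin d) {S : MState d} (hS : ∀ q ∈ S, q.1 u = 0 ∧ q.1 v = 0) :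
    smulState (swapPerm u v) S = S := by
  ext ⟨x, j⟩
  rw [mem_smulState]
  constructor
  · rintro ⟨r, hr, rfl⟩
    obtain ⟨hu, hv⟩ := hS _ hr
    rw [smulSite_swap_of_zero u v hu hv]; exact hr
  · intro hx
    obtain ⟨hu, hv⟩ := hS _ hx
    exact ⟨x, hx, (smulSite_swap_of_zero u v hu hv).symm⟩

/-- The transposition carries the letter `(u, b)` to `(v, b)`. [folklore] -/
theorem smulLetter_swap (u v : Fin d) (b : Bool) : smulLetter (swapPerm u v) (u, b) = (v, b) := by
  simp [smulLetter, swapPerm, Equiv.swap_apply_left]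

/-- **Fresh axes are interchangeable**: if a state vanishes on the axes `u` and `v`, reading `(v, b)` is reading `(u, b)`
followed by the transposition. [folklore] -/
theorem mstep_fresh (τ : ℕ) (u v : Fin d) (b : Bool) {S : MState d} (hS : ∀ q ∈ S, q.1 u = 0 ∧ q.1 v = 0) :
    mstep τ S (v, b) = (mstep τ S (u, b)).map (smulState (swapPerm u v)) := by
  have h := mstep_smul τ (swapPerm u v) S (u, b)
  rwa [smulState_swap_of_zero u v hS, smulLetter_swap] at h

end Fresh

end Summit.CriticalPhenomena.PercolationContinuityZ3.Theorems.Pcint
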